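import Summits.KontsevichZagierPeriods.KontsevichZagierPeriods.Theorems.RootDecompRelativeModAbsoluteRegKernelPairLeOneP02
import Summits.KontsevichZagierPeriods.KontsevichZagierPeriods.Theorems.RootDecompRelativeModAbsoluteRegFoldingDegOneP07
import Literature.NumberTheory.Transcendental.SemialgebraicAlgebraicPoints

/-!
(LANDED by the census seat decomp-kz-census-1 g7 `--supports stmt-KontsevichZagierPeriods-30572`; source lens-3 g9 landing package #2, critic decomp-kz-crit-1 g2 CLEARED §14–§17; generic docstrings added where the source had none.)

# `RegKernelPairDegOne` for `k + k' ≤ 1` (route `RootDecompRelativeModAbsolute`, first transcendence rung of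
support item stmt-KontsevichZagierPeriods-30572) — PROVED · part 3/3

Cell `decomp-kz`, lens 3 (decomp-kz-lens-3 g9).  `regKernelPairDegOne_of_add_le_one` (part 3/3) is the text of
the route item `RegKernelPairDegOne` VERBATIM under the extra hypothesis `k + k' ≤ 1`: ONE unfolded regularised
log/arctan monomial `[g.domain × (0,1), h(x) θ^M/(1+θ^e κ(x))]` (`e ∈ {1,2}`, any Taylor order `M`) against none —
if the folded fibre functions agree a.e. then the unfoldings are congruent modulo `KZ.relations`.
Part 1: scalar corollaries of Baker's theorem (`baker_holds`, incl. the unit-circle case for `arctan`) and the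
analysis of the kernels `θ^M/(1+θ^e κ)` (positivity, bounds, continuity of `ℓ_{M,e}` on `(-1,∞)` by dominated
convergence).  Part 2: `ℓ_{M,e}(0) = 1/(M+1)`, the recursion `κ ℓ_{M+e,e} = 1/(M+1) − ℓ_{M,e}`, the closed forms
`ℓ_{0,1} = log(1+κ)/κ`, `ℓ_{1,2} = log(1+κ)/(2κ)`, `ℓ_{0,2} = arctan √κ/√κ` resp. `(log(1+u) − log(1−u))/(2u)`
(`u = √(−κ)`) by FTC, and `transcendental_ell`: `ℓ_{M,e}(κ)` is transcendental at algebraic `κ ∈ (−1,∞)∖{0}`.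
Part 3: the rigidity lemma `mul_kappa_ae_eq_zero` (`1_G (g₀ + h ℓ_{M,e}(κ)) = 1_{G'} g₀'` a.e. with
`ℚ`-semialgebraic data forces `h κ = 0` a.e. — smooth full-measure loci, continuity, values at the dense algebraic
points), the KZ assembly `single_monomial`, and the rung theorem.

Source: `HOME/decomp-kz-lens-3/g9/RelativeModAbsoluteDegOneBands.lean` §14 (sha256 2ea10d4a6cc47b20, 5603 l; farm
rc 0 / 0 warn / 0 sorry; `#print axioms regKernelPairDegOne_of_add_le_one` = propext, Classical.choice, Quot.sound),
extracted verbatim into the namespace of the landed `RegFoldingDegOne` chain (toolkit §0–§13 =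
`RootDecompRelativeModAbsoluteRegFoldingDegOneP01…P14`).  No `sorry`; standard axioms.
References: Baker 1975 (Transcendental Number Theory) Thm 2.1 [tree: `baker_holds`]; [cite: KontsevichZagier2001, §1.2];
Bochnak–Coste–Roy 1998 §2.9.
-/

noncomputable section

open Set MeasureTheory Filter Topology
open scoped BigOperators
open Literature.NumberTheory.Transcendental Literature.ModelTheory.ExponentialFields

namespace Summit.KontsevichZagierPeriods.RootDecompRelativeModAbsolute.Rung30571

namespace RegularisedLogLayer

/-- (PRIVATE copy — the chain module RegFoldingDegOneP05 keeps this lemma private because its landed twin lives in a farm-unbuilt HyperbolicBloch module.) Finite sums of `ℚ`-semialgebraic functions are `ℚ`-semialgebraic. [BCR 1998, Prop. 2.2.6] -/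
private theorem isSemialgebraicFunOn_finset_sum {n : ℕ} {s : Set (Fin n → ℝ)} (hs : IsSemialgebraic ℚ s)
    {ι : Type*} (I : Finset ι) {f : ι → (Fin n → ℝ) → ℝ}
    (hf : ∀ i ∈ I, IsSemialgebraicFunOn ℚ s (f i)) :
    IsSemialgebraicFunOn ℚ s (fun x => ∑ i ∈ I, f i x) := by
  classical
  induction I using Finset.induction_on with
  | empty => exact (isSemialgebraicFunOn_ratCast hs 0).congr fun x _ => by simp
  | insert a I ha ih =>
    have h1 : IsSemialgebraicFunOn ℚ s (f a) := hf a (Finset.mem_insert_self a I)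
    have h2 := ih fun i hi => hf i (Finset.mem_insert_of_mem hi)
    refine (IsSemialgebraicFunOn.add_holds h1 h2).congr fun x _ => ?_
    simp only [Pi.add_apply, Finset.sum_insert ha]

/-! ### The rigidity step: `h·κ = 0` a.e. when `g₀ + h ℓ_{M,e}(κ)` is semialgebraic a.e. -/

/-- `isSemialgebraicFunOn_indicator'`: auxiliary theorem of the transcendence rungs of `RegKernelPairDegOne` (stmt-30572), lens-3 g9 §14–§17 — see the module docstring; verbatim from the lens file. -/
theorem isSemialgebraicFunOn_indicator' {b : ℕ} {s S : Set (Fin b → ℝ)} {f : (Fin b → ℝ) → ℝ}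
    (hs : IsSemialgebraic ℚ s) (hS : IsSemialgebraic ℚ S) (hf : IsSemialgebraicFunOn ℚ s f) :
    IsSemialgebraicFunOn ℚ S (s.indicator f) := by
  have h1 : IsSemialgebraicFunOn ℚ (S ∩ s) f := hf.mono inter_subset_right (hS.inter hs)
  have h0 : IsSemialgebraicFunOn ℚ (S \ s) (fun _ => ((0 : ℚ) : ℝ)) :=
    isSemialgebraicFunOn_ratCast (hS.diff hs) 0
  rw [isSemialgebraicFunOn_iff] at h1 h0 ⊢
  convert h1.union h0 using 1
  ext z
  simp only [mem_setOf_eq, mem_inter_iff, Set.mem_sdiff, mem_union, Rat.cast_zero]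
  by_cases h : Fin.init z ∈ s
  · simp [h]
  · simp [h]

/-- The points of `ℝ¹` with algebraic coordinate are dense. [folklore] -/
theorem dense_setOf_isAlgebraic : Dense {x : Fin 1 → ℝ | ∀ i, IsAlgebraic ℚ (x i)} := by
  rw [dense_iff_inter_open]
  rintro U hUo ⟨x, hxU⟩
  obtain ⟨ε, hε, hball⟩ := Metric.isOpen_iff.1 hUo x hxU
  obtain ⟨q, hq⟩ := Metric.denseRange_iff.1 Rat.denseRange_cast (x 0) ε hε
  refine ⟨fun _ => (q : ℝ), hball ?_, fun i => ?_⟩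
  · rw [Metric.mem_ball, dist_pi_lt_iff hε]
    intro i
    rw [Fin.fin_one_eq_zero i, dist_comm]
    exact hq
  · simpa using isAlgebraic_algebraMap (R := ℚ) (A := ℝ) q

/-- **Rigidity of one regularised monomial.** If `1_G (g₀ + h ℓ_{M,e}(κ)) = 1_{G'} g₀'` a.e. with all
data `ℚ`-semialgebraic (`κ > −1`, `e ∈ {1,2}`), then `h κ = 0` a.e. on `G`: off a null set everything
is continuous, so the identity holds at every algebraic point, where `ℓ_{M,e}(κ(x))` would be
algebraic — impossible for `κ(x) ≠ 0` by `transcendental_ell` (Baker); density and continuity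
finish. [Baker1975 Thm 2.1; folklore] -/
theorem mul_kappa_ae_eq_zero {G G' : Set (Fin 1 → ℝ)} (hG : IsSemialgebraic ℚ G)
    (hG' : IsSemialgebraic ℚ G') {g₀ g₀' h κ : (Fin 1 → ℝ) → ℝ}
    (hg₀ : IsSemialgebraicFunOn ℚ G g₀) (hg₀' : IsSemialgebraicFunOn ℚ G' g₀')
    (hh : IsSemialgebraicFunOn ℚ G h) (hκs : IsSemialgebraicFunOn ℚ G κ)
    (hκ1 : ∀ x ∈ G, -1 < κ x) {M e : ℕ} (he : e = 1 ∨ e = 2)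
    (hae : ∀ᵐ x, G.indicator (fun x => g₀ x + h x * ell M e (κ x)) x = G'.indicator g₀' x) :
    ∀ᵐ x, x ∈ G → h x * κ x = 0 := by
  classical
  have hψ : IsSemialgebraicFunOn ℚ G (G'.indicator g₀') := isSemialgebraicFunOn_indicator' hG' hG hg₀'
  obtain ⟨O₁, hO₁G, hO₁o, -, hc₁, -, hn₁⟩ := KZ.exists_isOpen_contDiffOn hG hh
  obtain ⟨O₂, hO₂G, hO₂o, -, hc₂, -, hn₂⟩ := KZ.exists_isOpen_contDiffOn hG hκs
  obtain ⟨O₃, hO₃G, hO₃o, -, hc₃, -, hn₃⟩ := KZ.exists_isOpen_contDiffOn hG hg₀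
  obtain ⟨O₄, hO₄G, hO₄o, -, hc₄, -, hn₄⟩ := KZ.exists_isOpen_contDiffOn hG hψ
  set O := O₁ ∩ O₂ ∩ O₃ ∩ O₄ with hO
  have hOo : IsOpen O := ((hO₁o.inter hO₂o).inter hO₃o).inter hO₄o
  have hOG : O ⊆ G := fun x hx => hO₁G hx.1.1.1
  have hnull : volume (G \ O) = 0 := by
    have hsub : G \ O ⊆ (G \ O₁) ∪ (G \ O₂) ∪ (G \ O₃) ∪ (G \ O₄) := by
      intro x hx
      simp only [hO, Set.mem_sdiff, mem_inter_iff, mem_union] at hx ⊢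
      tauto
    have h0 : volume ((G \ O₁) ∪ (G \ O₂) ∪ (G \ O₃) ∪ (G \ O₄)) = 0 := by
      rw [measure_union_null_iff, measure_union_null_iff, measure_union_null_iff]
      exact ⟨⟨⟨hn₁, hn₂⟩, hn₃⟩, hn₄⟩
    exact measure_mono_null hsub h0
  -- the defect function, continuous on `O` and zero a.e. there, hence zero on `O`
  set F : (Fin 1 → ℝ) → ℝ := fun x => g₀ x + h x * ell M e (κ x) - G'.indicator g₀' x with hF
  have hcont : ContinuousOn F O := by
    have c1 : ContinuousOn h O := hc₁.continuousOn.mono fun x hx => hx.1.1.1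
    have c2 : ContinuousOn κ O := hc₂.continuousOn.mono fun x hx => hx.1.1.2
    have c3 : ContinuousOn g₀ O := hc₃.continuousOn.mono fun x hx => hx.1.2
    have c4 : ContinuousOn (G'.indicator g₀') O := hc₄.continuousOn.mono fun x hx => hx.2
    have c5 : ContinuousOn (fun x => ell M e (κ x)) O :=
      (continuousOn_ell M e).comp c2 fun x hx => hκ1 x (hOG hx)
    exact (c3.add (c1.mul c5)).sub c4
  have hF0 : ∀ᵐ x, x ∈ O → F x = 0 := by
    filter_upwards [hae] with x hx hxO
    rw [indicator_of_mem (hOG hxO)] at hx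
    simp only [hF, hx, sub_self]
  have hFO : EqOn F 0 O := by
    have h1 : F =ᵐ[volume.restrict O] (0 : (Fin 1 → ℝ) → ℝ) :=
      (ae_restrict_iff' hOo.measurableSet).2 hF0
    exact Measure.eqOn_open_of_ae_eq h1 hOo hcont continuousOn_const
  -- at algebraic points of `O`: `h κ = 0`
  set A : Set (Fin 1 → ℝ) := {x | ∀ i, IsAlgebraic ℚ (x i)} with hA
  have hP_alg : EqOn (fun x => h x * κ x) 0 (O ∩ A) := by
    rintro x ⟨hxO, hxA⟩
    have hxG := hOG hxO
    by_contra hne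
    obtain ⟨hhx, hκx⟩ := mul_ne_zero_iff.1 hne
    have a1 := hg₀.isAlgebraic_apply hxG hxA
    have a2 := hh.isAlgebraic_apply hxG hxA
    have a3 := hκs.isAlgebraic_apply hxG hxA
    have a4 := hψ.isAlgebraic_apply hxG hxA
    have hFx : F x = 0 := hFO hxO
    have hell : ell M e (κ x) = (G'.indicator g₀' x - g₀ x) * (h x)⁻¹ := by
      have : g₀ x + h x * ell M e (κ x) - G'.indicator g₀' x = 0 := hFx
      field_simp
      linarith
    have halg : IsAlgebraic ℚ (ell M e (κ x)) := by
      rw [hell]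
      exact (a4.sub a1).mul a2.inv
    exact transcendental_ell (hκ1 x hxG) hκx a3 he halg
  -- density + continuity: `h κ = 0` on `O`
  have hPO : EqOn (fun x => h x * κ x) 0 O := by
    have cP : ContinuousOn (fun x => h x * κ x) O :=
      (hc₁.continuousOn.mono fun x hx => hx.1.1.1).mul (hc₂.continuousOn.mono fun x hx => hx.1.1.2)
    exact hP_alg.of_subset_closure cP continuousOn_const inter_subset_left
      (dense_setOf_isAlgebraic.open_subset_closure_inter hOo)
  -- a.e. on `G`
  have hae' : ∀ᵐ x, x ∉ G \ O := measure_eq_zero_iff_ae_notMem.1 hnull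
  filter_upwards [hae'] with x hx hxG
  by_cases hxO : x ∈ O
  · exact hPO hxO
  · exact absurd ⟨hxG, hxO⟩ hx

/-! ### The KZ assembly: one regularised monomial against none -/

/-- **One monomial against none.** If `[g] + [U]` unfolds the admissible one-monomial term
`[G; g; (h, κ, M, e)]` and its function agrees a.e. (zero-extended) with that of the monomial-free
term `[g']`, then `[g] + [U] ≡ [g']` in `KZ.relations`. [Baker1975 Thm 2.1; KZ 2001 §1.2; folklore] -/
theorem single_monomial (g g' : KZ.IntegralRep 1) {h κ : (Fin 1 → ℝ) → ℝ} {M e : ℕ}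
    (U : KZ.IntegralRep (1 + 1))
    (hh : IsSemialgebraicFunOn ℚ g.domain h) (hκs : IsSemialgebraicFunOn ℚ g.domain κ)
    (he : e = 1 ∨ e = 2) (hκ1 : ∀ x ∈ g.domain, -1 < κ x)
    (hdom : U.domain = RTerm.cyl g.domain)
    (hint : EqOn U.integrand
      (fun z => h (Fin.init z) * kernel M e (κ (Fin.init z)) (z (Fin.last 1))) U.domain)
    (hL1 : IntegrableOn (fun x => h x * ell M e (κ x)) g.domain)
    (hae : ∀ᵐ x : (Fin 1 → ℝ), g.domain.indicator (fun x => g.integrand x + h x * ell M e (κ x)) x =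
      g'.domain.indicator g'.integrand x) :
    KZ.of g + KZ.of U - KZ.of g' ∈ KZ.relations := by
  classical
  have hG : IsSemialgebraic ℚ g.domain := g.isSemialgebraic_domain
  have hGm : MeasurableSet g.domain := hG.measurableSet_holds
  -- Step 1: rigidity `h κ = 0` a.e. on `G`, hence `h ℓ(κ) = h/(M+1)` a.e. on `G`
  have hκ0 : ∀ᵐ x, x ∈ g.domain → h x * κ x = 0 :=
    mul_kappa_ae_eq_zero hG g'.isSemialgebraic_domain g.isSemialgebraicFunOn_integrand
      g'.isSemialgebraicFunOn_integrand hh hκs hκ1 he hae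
  have hval : ∀ᵐ x, x ∈ g.domain → h x * ell M e (κ x) = h x / (M + 1) := by
    filter_upwards [hκ0] with x hx hxG
    rcases mul_eq_zero.1 (hx hxG) with h0 | h0
    · simp [h0]
    · rw [h0, ell_at_zero]; ring
  -- Step 2: the polynomial representation `W = [G × (0,1), h(x) θ^M]`
  set a : Fin (M + 1) → (Fin 1 → ℝ) → ℝ := fun k x => if (k : ℕ) = M then h x else 0 with ha_def
  have ha : ∀ k, IsSemialgebraicFunOn ℚ g.domain (a k) := by
    intro k
    by_cases hk : (k : ℕ) = M
    · simp only [ha_def, hk, if_true]; exact hh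
    · simp only [ha_def, hk, if_false]
      exact (isSemialgebraicFunOn_ratCast hG 0).congr fun x _ => by simp
  have hsumA : ∀ (x : Fin 1 → ℝ) (θ : ℝ), ∑ k : Fin (M + 1), a k x * θ ^ (k : ℕ) = h x * θ ^ M := by
    intro x θ
    rw [Finset.sum_eq_single (Fin.last M)]
    · simp [ha_def]
    · intro k _ hk
      have : (k : ℕ) ≠ M := fun h' => hk (Fin.ext (by simp [h']))
      simp [ha_def, this]
    · simp
  have hsumB : ∀ x : Fin 1 → ℝ, ∑ k : Fin (M + 1), a k x / ((k : ℕ) + 1) = h x / (M + 1) := by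
    intro x
    rw [Finset.sum_eq_single (Fin.last M)]
    · simp [ha_def]
    · intro k _ hk
      have : (k : ℕ) ≠ M := fun h' => hk (Fin.ext (by simp [h']))
      simp [ha_def, this]
    · simp
  have hhi : IntegrableOn h g.domain := by
    have h1 : IntegrableOn (fun x => ((M : ℝ) + 1) * (h x * ell M e (κ x))) g.domain :=
      hL1.const_mul _
    refine h1.congr ((ae_restrict_iff' hGm).2 ?_)
    filter_upwards [hval] with x hx hxG
    rw [hx hxG]
    field_simp
  have hai : ∀ k, IntegrableOn (a k) g.domain := by
    intro k
    by_cases hk : (k : ℕ) = M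
    · simp only [ha_def, hk, if_true]; exact hhi
    · simp only [ha_def, hk, if_false]; exact integrableOn_zero
  have hcyl : IsSemialgebraic ℚ (RTerm.cyl g.domain) := RTerm.isSemialgebraic_cyl hG
  have hWsa : IsSemialgebraicFunOn ℚ (RTerm.cyl g.domain)
      (fun z : Fin (1 + 1) → ℝ => ∑ k : Fin (M + 1), a k (Fin.init z) * z (Fin.last 1) ^ (k : ℕ)) := by
    refine isSemialgebraicFunOn_finset_sum hcyl _ fun k _ => ?_
    exact (IsSemialgebraicFunOn.mul_holds ((ha k).comp_init_mono hcyl fun z hz => hz.1)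
      (isSemialgebraicFunOn_pow hcyl (isSemialgebraicFunOn_apply hcyl (Fin.last 1)) (k : ℕ))).congr
      fun z _ => rfl
  let W : KZ.IntegralRep (1 + 1) :=
    ⟨RTerm.cyl g.domain, fun z => ∑ k : Fin (M + 1), a k (Fin.init z) * z (Fin.last 1) ^ (k : ℕ),
      hcyl, hWsa, integrableOn_cyl_polynomial hG ha hai⟩
  obtain ⟨hTb, hfold⟩ := foldsTo_cyl_polynomial W hG ha rfl fun z _ => rfl
  -- `U` and `W` have a.e.-equal integrands on the cylinder
  have hN : volume {x | x ∈ g.domain ∧ h x * κ x ≠ 0} = 0 := by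
    rw [measure_eq_zero_iff_ae_notMem]
    filter_upwards [hκ0] with x hx hx'
    exact hx'.2 (hx hx'.1)
  have haeUW : ∀ᵐ z : (Fin (1 + 1) → ℝ), z ∈ U.domain → U.integrand z = W.integrand z := by
    have h2 := measure_eq_zero_iff_ae_notMem.1 (KZ.volume_setOf_init_mem_eq_zero hN)
    filter_upwards [h2] with z hz hzU
    have hzG : Fin.init z ∈ g.domain := (hdom ▸ hzU).1
    have hprod : h (Fin.init z) * κ (Fin.init z) = 0 := by
      by_contra hc
      exact hz ⟨hzG, hc⟩
    rw [hint hzU]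
    show h (Fin.init z) * kernel M e (κ (Fin.init z)) (z (Fin.last 1)) =
      ∑ k : Fin (M + 1), a k (Fin.init z) * z (Fin.last 1) ^ (k : ℕ)
    rw [hsumA]
    rcases mul_eq_zero.1 hprod with h0 | h0
    · simp [h0]
    · simp [kernel, h0]
  have hU := FoldsTo.of_ae_eq hdom haeUW hfold
  have hU1 : KZ.of U - KZ.of (RTerm.baseRep _ hTb) ∈ KZ.relations := by
    have := hU.1
    rwa [RTerm.unfold_base] at this
  -- Step 3: merge `[g]` with the folded base term by integrand additivity
  let S : KZ.IntegralRep 1 :=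
    ⟨g.domain, fun x => g.integrand x + ∑ k : Fin (M + 1), a k x / ((k : ℕ) + 1), hG,
      IsSemialgebraicFunOn.add_holds g.isSemialgebraicFunOn_integrand hTb.isSemialgebraicFunOn_h₀,
      g.integrableOn.add hTb.integrableOn_h₀⟩
  have hadd : KZ.of S - KZ.of g - KZ.of (RTerm.baseRep _ hTb) ∈ KZ.integrandAddRel :=
    ⟨1, S, g, RTerm.baseRep _ hTb, rfl, rfl, fun x _ => rfl, rfl⟩
  -- Step 4: `[S] ≡ [g']` by a.e. congruence of the zero-extended integrands
  have hS : KZ.of S - KZ.of g' ∈ KZ.relations := by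
    refine AECongr.of_sub_of_mem_relations_of_indicator_ae S g' ?_
    filter_upwards [hae, hval] with x hx hv
    by_cases hxG : x ∈ g.domain
    · rw [indicator_of_mem hxG] at hx
      rw [show S.domain = g.domain from rfl, indicator_of_mem hxG, ← hx]
      show g.integrand x + ∑ k : Fin (M + 1), a k x / ((k : ℕ) + 1) = g.integrand x + h x * ell M e (κ x)
      rw [hsumB, hv hxG]
    · rw [indicator_of_notMem hxG] at hx
      rw [show S.domain = g.domain from rfl, indicator_of_notMem hxG, hx]
  -- combine
  have e : KZ.of g + KZ.of U - KZ.of g' =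
      (KZ.of U - KZ.of (RTerm.baseRep _ hTb)) - (KZ.of S - KZ.of g - KZ.of (RTerm.baseRep _ hTb)) +
        (KZ.of S - KZ.of g') := by abel
  rw [e]
  exact add_mem (sub_mem hU1 (KZ.integrandAddRel_subset_relations hadd)) hS

/-- **Item 30572 `RegKernelPairDegOne` for `k + k' ≤ 1`** (VERBATIM binders plus the hypothesis
`k + k' ≤ 1`): the first decided instance of the transcendence piece with a logarithm / arctangent
present. [Baker1975 Thm 2.1; KZ 2001 §1.2; folklore] -/
theorem regKernelPairDegOne_of_add_le_one :
    ∀ (g g' : Literature.NumberTheory.Transcendental.KZ.IntegralRep 1) (k k' : ℕ) (h κ : Fin k → (Fin 1 → ℝ) → ℝ) (M e : Fin k → ℕ) (U : Fin k → Literature.NumberTheory.Transcendental.KZ.IntegralRep (1 + 1)) (h' κ' : Fin k' → (Fin 1 → ℝ) → ℝ) (M' e' : Fin k' → ℕ) (U' : Fin k' → Literature.NumberTheory.Transcendental.KZ.IntegralRep (1 + 1)), k + k' ≤ 1 → (∀ i, Literature.NumberTheory.Transcendental.IsSemialgebraicFunOn ℚ g.domain (h i)) → (∀ i, Literature.NumberTheory.Transcendental.IsSemialgebraicFunOn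 ℚ g.domain (κ i)) → (∀ i, e i = 1 ∨ e i = 2) → (∀ i, ∀ x ∈ g.domain, -1 < κ i x) → (∀ i, (U i).domain = {z : Fin (1 + 1) → ℝ | (Fin.init z : Fin 1 → ℝ) ∈ g.domain ∧ z (Fin.last 1) ∈ Set.Ioo 0 1}) → (∀ i, Set.EqOn (U i).integrand (fun z => h i (Fin.init z) * (z (Fin.last 1) ^ M i / (1 + z (Fin.last 1) ^ e i * κ i (Fin.init z)))) (U i).domain) → (∀ i, MeasureTheory.IntegrableOn (fun x => h i x * ∫ θ in Set.Ioo (0 : ℝ) 1, θ ^ M i / (1 + θ ^ e i * κ i x)) g.domain) → (∀ j, Literature.NumberTheory.Transcendental.IsSemialgebraicFunOn ℚ g'.domain (h' j)) → (∀ j, Literature.NumberTheory.Transcendental.IsSemialgebraicFunOn ℚ g'.domain (κ' j)) → (∀ j, e' j = 1 ∨ e' j = 2) → (∀ j, ∀ x ∈ g'.domain, -1 < κ' j x) → (∀ j, (U' j).domain = {z : Fin (1 + 1) → ℝ | (Fin.init z : Fin 1 → ℝ) ∈ g'.domain ∧ z (Fin.last 1) ∈ Set.Ioo 0 1}) → (∀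 j, Set.EqOn (U' j).integrand (fun z => h' j (Fin.init z) * (z (Fin.last 1) ^ M' j / (1 + z (Fin.last 1) ^ e' j * κ' j (Fin.init z)))) (U' j).domain) → (∀ j, MeasureTheory.IntegrableOn (fun x => h' j x * ∫ θ in Set.Ioo (0 : ℝ) 1, θ ^ M' j / (1 + θ ^ e' j * κ' j x)) g'.domain) → (∀ᵐ x : (Fin 1 → ℝ), g.domain.indicator (fun x => g.integrand x + ∑ i, h i x * ∫ θ in Set.Ioo (0 : ℝ) 1, θ ^ M i / (1 + θ ^ e i * κ i x)) x = g'.domain.indicator (fun x => g'.integrand x + ∑ j, h' j x * ∫ θ in Set.Ioo (0 : ℝ) 1, θ ^ M' j / (1 + θ ^ e' j * κ' j x)) x) → (Literature.NumberTheory.Transcendental.KZ.of g + ∑ i, Literature.NumberTheory.Transcendental.KZ.of (U i)) - (Literature.NumberTheory.Transcendental.KZ.of g' + ∑ j, Literature.NumberTheory.Transcendental.KZ.of (U' j)) ∈ Literature.NumberTheory.Transcendental.KZ.relations := by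
  intro g g' k k' h κ M e U h' κ' M' e' U' hkk hh hκ hem hκ1 hdom hint hL1 hh' hκ' hem' hκ1' hdom'
    hint' hL1' hae
  rcases k with _ | _ | k
  · rcases k' with _ | _ | k'
    · -- `k = k' = 0`: the monomial-free case
      simp only [Finset.univ_eq_empty, Finset.sum_empty, add_zero] at hae ⊢
      exact AECongr.of_sub_of_mem_relations_of_indicator_ae g g' hae
    · -- `k = 0`, `k' = 1`
      simp only [Fin.sum_univ_succ, Finset.univ_eq_empty, Finset.sum_empty, add_zero] at hae ⊢
      have h1 := single_monomial g' g (U' 0) (hh' 0) (hκ' 0) (hem' 0) (hκ1' 0) (hdom' 0) (hint' 0)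
        (hL1' 0) (hae.mono fun x hx => hx.symm)
      have e1 : KZ.of g - (KZ.of g' + KZ.of (U' 0)) = -(KZ.of g' + KZ.of (U' 0) - KZ.of g) := by abel
      rw [e1]
      exact neg_mem h1
    · omega
  · rcases k' with _ | k'
    · -- `k = 1`, `k' = 0`
      simp only [Fin.sum_univ_succ, Finset.univ_eq_empty, Finset.sum_empty, add_zero] at hae ⊢
      exact single_monomial g g' (U 0) (hh 0) (hκ 0) (hem 0) (hκ1 0) (hdom 0) (hint 0) (hL1 0) hae
    · omega
  · omega

end RegularisedLogLayer

end Summit.KontsevichZagierPeriods.RootDecompRelativeModAbsolute.Rung30571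

end
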